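import Summits.HodgeConjecture.HodgeConjecture.Theorems.SignSymmetricPowersPencilTransvections
import Literature.AlgebraicGeometry.HodgeTheory.MonomialSupportedHypersurfaceFamilyPoints
import Literature.AlgebraicGeometry.HodgeTheory.BettiUniverseOddCupAlternating
import Literature.AlgebraicGeometry.HodgeTheory.PicardLefschetzExchangedPairOfOneNode
import Summits.HodgeConjecture.HodgeConjecture.Theorems.SignSymmetricPowersPencilTransvectionsPair
import HarnessLib

/-!
# K1-B piece PEN of crux `VeryGeneralSignCommutatorsInHg` — UNCONDITIONAL (registry v25: both Picard–Lefschetz binders discharged)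

Prover seat `hodge-nonav-19716-p2` (g10), cell `hodge-nonav`; helper `--supports stmt-HodgeConjecture-19716`; sorry-free, no definition, no named fact,
NO Picard–Lefschetz hypothesis.  The Π∕L fixed-node clauses are `SignSymmetricPowersPencilTransvectionsPair.transvection_of_fixed_node_monomial`
(prover-Bx's `NodalPencil.picardLefschetz_oneNode_monomial`, p680592); the exchanged-pair clause is now served by seat 20241-p1's THEOREM
`picardLefschetz_exchangedPair_monomial` (`PicardLefschetzExchangedPairOfOneNode`, p684662: programme PL2-MERIDIANS) in the monomial direction
`g = a'·xᵢ^d` (the telescope instantiates `x₂^d`).  All three clauses carry the hypothesis `∃ i a, g = a • X i ^ d`.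

* `transvections_of_exchanged_pair_solo` (UNCONDITIONAL), `signPencilTransvections_solo` (the PEN statement of skeleton v12d, monomial directions,
  parity clauses dropped, NO antecedent).

Sorry-free; axioms standard.  Nothing here says HC is proved; rung F-H1 not moved.

## References

* [VoisinHodgeII2003] C. Voisin, Hodge Theory and Complex Algebraic Geometry II (CUP 2003), §3.2.1 Thm. 3.16, Cor. 3.17, §3.2.2, §2.2.1 Def. 2.12.
* [ArnoldGuseinzadeVarchenko2012] Arnold, Gusein-Zade, Varchenko, Singularities of Differentiable Maps II, Part I §1.3, p. 67 Corollary.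
* [Deligne1980] P. Deligne, La conjecture de Weil II, §4.4.
-/

noncomputable section

set_option linter.dupNamespace false

open CategoryTheory AlgebraicGeometry
open scoped LinearAlgebra.Projectivization
open Literature.AlgebraicTopology.SingularHomology
open Literature.AlgebraicGeometry.Motives Literature.AlgebraicGeometry.Motives.UniversalHypersurface
open Literature.AlgebraicGeometry.HodgeTheory Literature.AlgebraicGeometry.HodgeTheory.UniversalHypersurface
open Literature.AlgebraicGeometry.HodgeTheory.BettiUniverse
open Summit.HodgeConjecture.HodgeConjecture.Theorems.SignSymmetricPowersPencilTransport
open Summit.HodgeConjecture.HodgeConjecture.Theorems.SignSymmetricPowersPencilTransvections (oneParamTransvectionEquiv_congr)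

namespace Summit.HodgeConjecture.HodgeConjecture.Theorems.SignSymmetricPowersPencilTransvectionsSolo

/-! ### §1 One fixed node: `SignSymmetricPowersPencilTransvectionsPair.transvection_of_fixed_node_monomial` (UNCONDITIONAL, reused) -/

/-! ### §2 An exchanged pair of nodes: the moved pencil circle transports by `U_δ(c) U_{σ^*δ}(c)` -/

/-- **A pencil circle around an ι-even member with TWO nodes exchanged by `γ`, moved to any base point,
transports `H³` by the commuting product `U_δ(c) U_{τδ}(c)`**, `c ≠ 0`, `B(δ, δ) = B(τδ, τδ) = B(δ, τδ) = 0`,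
`τ = σ_t^*`: the two vanishing cycles are `B`-orthogonal and isotropic (odd fibre dimension), and `σ'^*`
exchanges them up to sign (the exchange clause (O) of 20241-p1's THEOREM `picardLefschetz_exchangedPair_monomial` for the
symmetry `γ`; Wall's sign rule is not used), the sign being absorbed by `U_{-δ} = U_δ`.  Verbatim the parents
`transvections_of_exchanged_pair{,_exchange,_keyed}`, now UNCONDITIONAL for a monomial co-pencil direction. [cite: VoisinHodgeII2003, §3.2.1 Thm. 3.16 and §2.2.1 Def. 2.12]
[cite: ArnoldGuseinzadeVarchenko2012, Part I p. 67 Corollary] -/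
theorem transvections_of_exchanged_pair_solo {d : ℕ} (hd : 1 ≤ d)
    (M : Set (DegIndex 3 d)) (γ : Fin 5 → ℂˣ) (hγ : FixesMonomials ℂ 3 d M γ)
    (hU : IsCohomologicallyLocallyTrivialOn (familyM ℂ 3 d M) Set.univ)
    (q : Fin 2 → Fin 5 → ℂ) (hq : ∃ t : ℂ, γ • q 1 = t • q 0)
    (f₁ g : MvPolynomial (Fin 5) ℂ) (hf₁ : f₁.IsHomogeneous d) (hg : g.IsHomogeneous d)
    (hgX : ∃ (i : Fin 5) (a : ℂ), g = a • MvPolynomial.X i ^ d)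
    (hM₁ : IsSupportedOn 3 d M f₁) (hMg : IsSupportedOn 3 d M g) (hnod : IsNodalFormWithNodes f₁ q)
    (hgp : ∀ i : Fin 2, MvPolynomial.eval (q i) g ≠ 0) :
    ∃ ε₀ : ℝ, 0 < ε₀ ∧ ∀ ε : ℝ, 0 < ε → ε < ε₀ → ∀ (t s : ComplexPoints (baseM ℂ 3 d M)) (β : Path t s)
      (ω : Path s s), pointFormM ℂ 3 d M s = f₁ + ((ε : ℝ) : ℂ) • g →
      IsPencilCircle 3 d f₁ g ε (ω.map (AlgPoints.mapContinuous (toBase ℂ 3 d M)).continuous) →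
      ∀ T : bettiCohomology (fiberOver (familyM ℂ 3 d M) t) 3 ≃ₗ[ℚ] bettiCohomology (fiberOver (familyM ℂ 3 d M) t) 3,
        IsRatTransport (familyM ℂ 3 d M) 3 hU ⟦((β.trans ω).trans β.symm).map
          (⟨fun s => ⟨s, Set.mem_univ s⟩, continuous_id.subtype_mk _⟩ : C(ComplexPoints (baseM ℂ 3 d M), (Set.univ : Set (ComplexPoints (baseM ℂ 3 d M))))).continuous⟧ T →
        ∃ (δ : bettiCohomology (fiberOver (familyM ℂ 3 d M) t) 3) (c : ℚ)
          (hδ : ((cup (fiberOver (familyM ℂ 3 d M) t) 3 3).compr₂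
            (tr (isSmoothProjective_fiberOver_familyM ℂ 3 d M (by decide) hd t) (3 + 3))) δ δ = 0)
          (hδ' : ((cup (fiberOver (familyM ℂ 3 d M) t) 3 3).compr₂
            (tr (isSmoothProjective_fiberOver_familyM ℂ 3 d M (by decide) hd t) (3 + 3)))
              (pull (sigmaMFiber ℂ 3 d M γ hγ t) 3 δ) (pull (sigmaMFiber ℂ 3 d M γ hγ t) 3 δ) = 0),
          c ≠ 0 ∧ ((cup (fiberOver (familyM ℂ 3 d M) t) 3 3).compr₂
            (tr (isSmoothProjective_fiberOver_familyM ℂ 3 d M (by decide) hd t) (3 + 3))) δ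
              (pull (sigmaMFiber ℂ 3 d M γ hγ t) 3 δ) = 0 ∧
          T = oneParamTransvectionEquiv _ hδ c * oneParamTransvectionEquiv _ hδ' c := by
  have hγ₁ : γ ∈ diagonalStabilizer f₁ := mem_diagonalStabilizer_of_isSupportedOn hγ hf₁ hM₁
  have hγg : γ ∈ diagonalStabilizer g := mem_diagonalStabilizer_of_isSupportedOn hγ hg hMg
  obtain ⟨i, a', hgi⟩ := hgX
  have H := Literature.AlgebraicGeometry.HodgeTheory.picardLefschetz_exchangedPair_monomial 3 d (by decide) hd f₁ hf₁ i a' q hnod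
    (fun j => hgi ▸ hgp j) γ hγ₁ (hgi ▸ hγg) hq
  rw [← hgi] at H
  obtain ⟨ε₀, hε₀, -, hcirc⟩ := H
  refine ⟨ε₀, hε₀, fun ε hε hεε t s β ω hs hω T hT => ?_⟩
  obtain ⟨δ, c₀, hPL, hEq⟩ := hcirc (UniversalHypersurface.isCohomologicallyLocallyTrivialOn_family 3 d hd) ε hε hεε
    (AlgPoints.map (toBase ℂ 3 d M) s) hs (ω.map (AlgPoints.mapContinuous (toBase ℂ 3 d M)).continuous) hω
    (fun he => absurd he (by decide))
  obtain ⟨c', Φ, hc', hform, ⟨ν, -, hsim⟩, hequi⟩ :=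
    exists_transport_picardLefschetz 3 d M γ (by decide) hd hγ _ hU β ω hPL hT
  -- `σ'^* δ₀ = ± δ₁`
  have hexch := hEq _ (fibrePoint_map_conj_sigmaMFiber 3 d M γ hγ s)
  set B := ((cup (fiberOver (familyM ℂ 3 d M) t) 3 3).compr₂
    (tr (isSmoothProjective_fiberOver_familyM ℂ 3 d M (by decide) hd t) (3 + 3))) with hBdef
  have hBalt : B.IsAlt := isAlt_tr_cup_of_odd _ (by decide)
  have hB00 : B (Φ (δ 0)) (Φ (δ 0)) = 0 := by
    rw [hBdef, LinearMap.compr₂_apply, hsim, hPL.odd (by decide) 0, mul_zero]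
  have hB11 : B (Φ (δ 1)) (Φ (δ 1)) = 0 := by
    rw [hBdef, LinearMap.compr₂_apply, hsim, hPL.odd (by decide) 1, mul_zero]
  have hB01 : B (Φ (δ 0)) (Φ (δ 1)) = 0 := by
    rw [hBdef, LinearMap.compr₂_apply, hsim, hPL.orthogonal (show (0 : Fin 2) ≠ 1 by decide), mul_zero]
  have hB10 : B (Φ (δ 1)) (Φ (δ 0)) = 0 := by
    rw [hBdef, LinearMap.compr₂_apply, hsim, hPL.orthogonal (show (1 : Fin 2) ≠ 0 by decide), mul_zero]
  -- `τ (Φ δ₀) = ± Φ δ₁`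
  have hτ : pull (sigmaMFiber ℂ 3 d M γ hγ t) 3 (Φ (δ 0)) = Φ (δ 1) ∨
      pull (sigmaMFiber ℂ 3 d M γ hγ t) 3 (Φ (δ 0)) = -Φ (δ 1) := by
    rw [hequi]
    rcases hexch with h | h
    · exact Or.inl (congrArg Φ h)
    · exact Or.inr (by rw [h, map_neg])
  have hτB : B (pull (sigmaMFiber ℂ 3 d M γ hγ t) 3 (Φ (δ 0))) (pull (sigmaMFiber ℂ 3 d M γ hγ t) 3 (Φ (δ 0))) = 0 := by
    rcases hτ with h | h
    · rw [h, hB11]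
    · rw [h, map_neg, map_neg, LinearMap.neg_apply, neg_neg, hB11]
  have hτB' : B (Φ (δ 0)) (pull (sigmaMFiber ℂ 3 d M γ hγ t) 3 (Φ (δ 0))) = 0 := by
    rcases hτ with h | h
    · rw [h, hB01]
    · rw [h, map_neg, hB01, neg_zero]
  have hUτ : oneParamTransvectionEquiv B hτB c' = oneParamTransvectionEquiv B hB11 c' := by
    rcases hτ with h | h
    · exact oneParamTransvectionEquiv_congr B h _ _ c'
    · rw [oneParamTransvectionEquiv_congr B h hτB (hBalt (-Φ (δ 1))) c', oneParamTransvectionEquiv_neg]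
  refine ⟨Φ (δ 0), c', hB00, hτB, hc', hτB', ?_⟩
  rw [hUτ]
  refine LinearEquiv.ext fun x => ?_
  rw [hform x, oneParamTransvectionEquiv_mul_apply_of_orthogonal B hB00 hB11 hB10 c' x, Fin.sum_univ_two,
    smul_add, smul_smul, smul_smul, hBdef, LinearMap.compr₂_apply, LinearMap.compr₂_apply, add_assoc]


/-! ### §3 The PEN statement with unsigned fixed centres, from the keyed binders -/

/-- **PEN with unsigned fixed centres — UNCONDITIONAL** (the registered stub `stub_signPencilTransvections` of skeleton v12d with NO antecedent,
the three clauses restricted to monomial co-pencil directions and the two parity clauses dropped): for every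
even `d ≥ 4`, every admissible ι-even `f` and each node type — Π-node `e₄`, L-node `e₀`, the exchanged pair `(±1:0:1:0:0)` — every
small pencil circle around an ι-even nodal member of that type, moved to `t` along any path, transports `H³(𝒴_t; ℚ)` by `U_r(c)`
with `c ≠ 0`, `B(r,r) = 0` (Π, L), resp. by `U_δ(c) U_{τδ}(c)` with `B(δ, τδ) = 0` (pair; `γ • (−1:0:1:0:0) = (1:0:1:0:0)`).
[cite: VoisinHodgeII2003, §3.2.1 Thm. 3.16 and §3.2.2] [cite: ArnoldGuseinzadeVarchenko2012, Part I §1.3 and p. 67 Corollary] -/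
theorem signPencilTransvections_solo :
    open Literature.AlgebraicGeometry.Motives Literature.AlgebraicGeometry.Motives.UniversalHypersurface Literature.AlgebraicGeometry.HodgeTheory Literature.AlgebraicGeometry.HodgeTheory.UniversalHypersurface Literature.AlgebraicGeometry.HodgeTheory.BettiUniverse CategoryTheory.Limits in ∀ ⦃d : ℕ⦄, Even d → ∀ (h4 : 4 ≤ d), (let M : Set (DegIndex 3 d) := {m | Even (m.1 0 + m.1 1)}; let γ : Fin 5 → ℂˣ := fun i => if (i : ℕ) < 2 then -1 else 1; let u := familyM ℂ 3 d M; let hu : IsSmoothProjectiveFamily u 3 := isSmoothProjectiveFamily_familyM ℂ 3 d M (by decide) (le_trans (by decide) h4); let hU : IsCohomologicallyLocallyTrivialOn u (Set.univ : Set (ComplexPoints (baseM ℂ 3 d M))) := isCohomologicallyLocallyTrivialOn_familyM 3 d M (by decide) (le_trans (by decide) h4); let toU : C(ComplexPoints (baseM ℂ 3 d M), (Set.univ : Set (ComplexPoints (baseM ℂ 3 d M)))) := ⟨fun s => ⟨s, Set.mem_univ s⟩, continuous_id.subtype_mk _⟩; ∀ (hγ : FixesMonomials ℂ 3 d M γ)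 (t₀ : ComplexPoints (baseM ℂ 3 d M)) (f : MvPolynomial (Fin 5) ℂ) (hf : f.IsHomogeneous d) (hM : IsSupportedOn 3 d M f) (hJ : SmoothHypersurface.IsNonsingularForm ℂ f), let t := classifyingPoint ℂ 3 d M t₀ f; let Y := fiberOver u t; let hY : IsSmoothProjective 3 Y := hu.isSmoothProjective t; let B : LinearMap.BilinForm ℚ (bettiCohomology Y 3) := (cup Y 3 3).compr₂ (tr hY (3 + 3)); let τ : bettiCohomology Y 3 →ₗ[ℚ] bettiCohomology Y 3 := pull (sigmaMFiber ℂ 3 d M γ hγ t) 3; (∀ (f₁ g : MvPolynomial (Fin 5) ℂ), f₁.IsHomogeneous d → g.IsHomogeneous d → (∃ (i : Fin 5) (a : ℂ), g = a • MvPolynomial.X i ^ d) → IsSupportedOn 3 d M f₁ → IsSupportedOn 3 d M g → IsNodalFormWithNodes f₁ ![![0, 0, 0, 0, 1]] → (∀ i : Fin 1, MvPolynomial.eval (![![0, 0, 0, 0, 1]] i) g ≠ 0) → ∃ ε₀ : ℝ, 0 < ε₀ ∧ ∀ ε : ℝ, 0 < ε → ε < ε₀ → ∀ (s : ComplexPoints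 (baseM ℂ 3 d M)) (β : Path t s) (ω : Path s s), pointFormM ℂ 3 d M s = f₁ + ((ε : ℝ) : ℂ) • g → IsPencilCircle 3 d f₁ g ε (ω.map (AlgPoints.mapContinuous (toBase ℂ 3 d M)).continuous) → ∀ T : bettiCohomology Y 3 ≃ₗ[ℚ] bettiCohomology Y 3, IsRatTransport u 3 hU ⟦((β.trans ω).trans β.symm).map toU.continuous⟧ T → ∃ (r : bettiCohomology Y 3) (c : ℚ) (hr : B r r = 0), c ≠ 0 ∧ T = oneParamTransvectionEquiv B hr c) ∧ (∀ (f₁ g : MvPolynomial (Fin 5) ℂ), f₁.IsHomogeneous d → g.IsHomogeneous d → (∃ (i : Fin 5) (a : ℂ), g = a • MvPolynomial.X i ^ d) → IsSupportedOn 3 d M f₁ → IsSupportedOn 3 d M g → IsNodalFormWithNodes f₁ ![![1, 0, 0, 0, 0]] → (∀ i : Fin 1, MvPolynomial.eval (![![1, 0, 0, 0, 0]] i) g ≠ 0) → ∃ ε₀ : ℝ, 0 < ε₀ ∧ ∀ ε : ℝ, 0 < ε → ε < ε₀ → ∀ (s : ComplexPoints (baseM ℂ 3 d M)) (β : Path t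 s) (ω : Path s s), pointFormM ℂ 3 d M s = f₁ + ((ε : ℝ) : ℂ) • g → IsPencilCircle 3 d f₁ g ε (ω.map (AlgPoints.mapContinuous (toBase ℂ 3 d M)).continuous) → ∀ T : bettiCohomology Y 3 ≃ₗ[ℚ] bettiCohomology Y 3, IsRatTransport u 3 hU ⟦((β.trans ω).trans β.symm).map toU.continuous⟧ T → ∃ (r : bettiCohomology Y 3) (c : ℚ) (hr : B r r = 0), c ≠ 0 ∧ T = oneParamTransvectionEquiv B hr c) ∧ (∀ (f₁ g : MvPolynomial (Fin 5) ℂ), f₁.IsHomogeneous d → g.IsHomogeneous d → (∃ (i : Fin 5) (a : ℂ), g = a • MvPolynomial.X i ^ d) → IsSupportedOn 3 d M f₁ → IsSupportedOn 3 d M g → IsNodalFormWithNodes f₁ ![![1, 0, 1, 0, 0], ![-1, 0, 1, 0, 0]] → (∀ i : Fin 2, MvPolynomial.eval (![![1, 0, 1, 0, 0], ![-1, 0, 1, 0, 0]] i) g ≠ 0) → ∃ ε₀ : ℝ, 0 < ε₀ ∧ ∀ ε : ℝ, 0 < ε → ε < ε₀ → ∀ (s : ComplexPoints (baseM ℂ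 3 d M)) (β : Path t s) (ω : Path s s), pointFormM ℂ 3 d M s = f₁ + ((ε : ℝ) : ℂ) • g → IsPencilCircle 3 d f₁ g ε (ω.map (AlgPoints.mapContinuous (toBase ℂ 3 d M)).continuous) → ∀ T : bettiCohomology Y 3 ≃ₗ[ℚ] bettiCohomology Y 3, IsRatTransport u 3 hU ⟦((β.trans ω).trans β.symm).map toU.continuous⟧ T → ∃ (δ : bettiCohomology Y 3) (c : ℚ) (hδ : B δ δ = 0) (hδ' : B (τ δ) (τ δ) = 0), c ≠ 0 ∧ B δ (τ δ) = 0 ∧ T = oneParamTransvectionEquiv B hδ c * oneParamTransvectionEquiv B hδ' c)) := by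
  intro d hd h4 M γ u hu hU toU hγ t₀ f hf hM hJ t Y hY B τ
  have hd1 : 1 ≤ d := le_trans (by decide) h4
  refine ⟨?_, ?_, ?_⟩
  · -- Π-node `e₄` (no parity recorded)
    intro f₁ g hf₁ hg hgX hM₁ hMg hnod hgp
    obtain ⟨ε₀, hε₀, hh⟩ := SignSymmetricPowersPencilTransvectionsPair.transvection_of_fixed_node_monomial hd1 M γ hγ hU _ f₁ g hf₁ hg hgX
      hnod hgp
    refine ⟨ε₀, hε₀, fun ε hε hεε s β ω hs hω T hT => ?_⟩
    obtain ⟨r, c, hr, hc, hT'⟩ := hh ε hε hεε t s β ω hs hω T hT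
    exact ⟨r, c, hr, hc, hT'⟩
  · -- L-node `e₀` (no parity recorded)
    intro f₁ g hf₁ hg hgX hM₁ hMg hnod hgp
    obtain ⟨ε₀, hε₀, hh⟩ := SignSymmetricPowersPencilTransvectionsPair.transvection_of_fixed_node_monomial hd1 M γ hγ hU _ f₁ g hf₁ hg hgX
      hnod hgp
    refine ⟨ε₀, hε₀, fun ε hε hεε s β ω hs hω T hT => ?_⟩
    obtain ⟨r, c, hr, hc, hT'⟩ := hh ε hε hεε t s β ω hs hω T hT
    exact ⟨r, c, hr, hc, hT'⟩
  · -- exchanged pair `(±1:0:1:0:0)`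
    intro f₁ g hf₁ hg hgX hM₁ hMg hnod hgp
    have hq : ∃ t' : ℂ, γ • ((![![1, 0, 1, 0, 0], ![-1, 0, 1, 0, 0]] : Fin 2 → Fin 5 → ℂ) 1) =
        t' • ((![![1, 0, 1, 0, 0], ![-1, 0, 1, 0, 0]] : Fin 2 → Fin 5 → ℂ) 0) :=
      ⟨1, by funext i; fin_cases i <;> simp [γ]⟩
    obtain ⟨ε₀, hε₀, hh⟩ := transvections_of_exchanged_pair_solo hd1 M γ hγ hU _ hq f₁ g hf₁ hg hgX hM₁ hMg hnod hgp
    refine ⟨ε₀, hε₀, fun ε hε hεε s β ω hs hω T hT => ?_⟩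
    obtain ⟨δ, c, hδ, hδ', hc, horth, hT'⟩ := hh ε hε hεε t s β ω hs hω T hT
    exact ⟨δ, c, hδ, hδ', hc, horth, hT'⟩

end Summit.HodgeConjecture.HodgeConjecture.Theorems.SignSymmetricPowersPencilTransvectionsSolo

end
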